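import Summits.AtomisticToContinuum.Crystallization.Theorems.PhononStability.Negative.Mirror
import Summits.AtomisticToContinuum.Crystallization.Theorems.CoarseGrains.Negative.PredicateAPI
import Literature.MathematicalPhysics.StatisticalMechanics.MuGroundStateConfiguration

/-!
# `ExcessDecayLiouville.GrainsGlue`, helper file 1: the Lennard-Jones force field of a separated set

Route `ExcessDecayLiouville` (sub-problem `Crystallization`), support item
`stmt-AtomisticToContinuum-9336` (`GrainsGlue`).  Estimates on the pair force
`F(p, q) = (V′(|p − q|)/|p − q|)(p − q)` of the Lennard-Jones potential `V = r⁻¹²/12 − r⁻⁶/6` over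
uniformly discrete point sets of `ℝ³`, used to pass force balance to local limits:

* `norm_force_eq` — `‖F(p, q)‖ = |V′(|p − q|)|` for `p ≠ q`;
* `abs_deriv_lennardJones_le` — `|V′(t)| ≤ (ρ⁻⁷ + ρ⁻¹) t⁻⁶` for `t ≥ ρ > 0`;
* `abs_deriv_lennardJones_le_of_le` — `|V′(t)| ≤ (2/L) t⁻⁶` for `t ≥ L ≥ 1` (the far field);
* `sum_norm_force_le` — over a finite set of points pairwise `≥ ρ` apart and `≥ ρ` from `r`,
  `∑ ‖F(r, ·)‖ ≤ (ρ⁻⁷ + ρ⁻¹) · 250 ρ⁻⁶` (shell counting, `sum_inv_pow_six_le_of_forall_le_dist`);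
* `sum_norm_force_le_of_far` — if moreover all points are `≥ L ≥ 1 ≥ ρ` from `r`, the sum is
  `≤ 500 ρ⁻⁶ / L` (uniform far-field tail, the only analytic input of the limit argument);
* `summable_norm_force` / `summable_force` — absolute summability of `q ↦ F(p, q)` over
  `{q ∈ Y, q ≠ p}` for a `ρ`-separated `Y ∋ p`, and `norm_tsum_force_compl_le` — the norm of the
  sum over the indices outside a finite set containing all points at distance `< L` from `p` is
  `≤ 500 ρ⁻⁶ / L`.
-/

noncomputable section

open scoped BigOperators Topology
open Filter Literature.MathematicalPhysics.StatisticalMechanics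

namespace Summit.AtomisticToContinuum.Crystallization.Theorems.ExcessDecayLiouvilleGrainsGlue

open PhononStabilityNegative (deriv_lennardJones)

open Summit.AtomisticToContinuum.Crystallization.Theorems.CoarseGrains.Negative.PredicateAPI (E3)

/-! ### Pointwise bounds -/

/-- `‖F(p, q)‖ = |V′(|p − q|)|` for `p ≠ q`. [folklore] -/
theorem norm_force_eq {p q : E3} (hpq : p ≠ q) :
    ‖(deriv lennardJones (dist p q) / dist p q) • (p - q)‖ = |deriv lennardJones (dist p q)| := by
  have hd : 0 < dist p q := dist_pos.2 hpq
  rw [norm_smul, Real.norm_eq_abs, abs_div, abs_of_pos hd, ← dist_eq_norm, div_mul_cancel₀]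
  exact hd.ne'

/-- `‖F(p, q)‖ ≤ |V′(|p − q|)|` always (equality off the diagonal, `0 ≤ 0` on it). [folklore] -/
theorem norm_force_le (p q : E3) :
    ‖(deriv lennardJones (dist p q) / dist p q) • (p - q)‖ ≤ |deriv lennardJones (dist p q)| := by
  rcases eq_or_ne p q with rfl | hpq
  · simp
  · exact (norm_force_eq hpq).le

/-- `|V′(t)| ≤ (ρ⁻⁷ + ρ⁻¹) t⁻⁶` for `t ≥ ρ > 0` (`V′(t) = −t⁻¹³ + t⁻⁷`). [folklore] -/
theorem abs_deriv_lennardJones_le {ρ t : ℝ} (hρ : 0 < ρ) (ht : ρ ≤ t) :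
    |deriv lennardJones t| ≤ (ρ⁻¹ ^ 7 + ρ⁻¹) * t⁻¹ ^ 6 := by
  have ht0 : 0 < t := hρ.trans_le ht
  rw [deriv_lennardJones ht0.ne']
  have hi : t⁻¹ ≤ ρ⁻¹ := (inv_le_inv₀ ht0 hρ).2 ht
  have hi0 : 0 ≤ t⁻¹ := inv_nonneg.2 ht0.le
  have h7 : t⁻¹ ^ 7 ≤ ρ⁻¹ ^ 7 := pow_le_pow_left₀ hi0 hi 7
  have h6 : 0 ≤ t⁻¹ ^ 6 := by positivity
  have e13 : t⁻¹ ^ 13 = t⁻¹ ^ 7 * t⁻¹ ^ 6 := by ring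
  have e7 : t⁻¹ ^ 7 = t⁻¹ * t⁻¹ ^ 6 := by ring
  refine abs_le.2 ⟨?_, ?_⟩
  · rw [e13, e7]
    nlinarith [mul_le_mul_of_nonneg_right h7 h6, mul_le_mul_of_nonneg_right hi h6,
      mul_nonneg hi0 h6, mul_nonneg (pow_nonneg hi0 7) h6]
  · rw [e13, e7]
    nlinarith [mul_le_mul_of_nonneg_right h7 h6, mul_le_mul_of_nonneg_right hi h6,
      mul_nonneg hi0 h6, mul_nonneg (pow_nonneg hi0 7) h6]

/-- Far field: `|V′(t)| ≤ (2/L) t⁻⁶` for `t ≥ L ≥ 1`. [folklore] -/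
theorem abs_deriv_lennardJones_le_of_le {L t : ℝ} (hL : 1 ≤ L) (ht : L ≤ t) :
    |deriv lennardJones t| ≤ 2 / L * t⁻¹ ^ 6 := by
  have ht0 : 0 < t := by linarith
  have ht1 : 1 ≤ t := hL.trans ht
  rw [deriv_lennardJones ht0.ne']
  have hi1 : t⁻¹ ≤ 1 := inv_le_one_of_one_le₀ ht1
  have hi0 : 0 ≤ t⁻¹ := inv_nonneg.2 ht0.le
  have hiL : t⁻¹ ≤ L⁻¹ := (inv_le_inv₀ ht0 (by linarith)).2 ht
  have h6 : 0 ≤ t⁻¹ ^ 6 := by positivity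
  have h7le : t⁻¹ ^ 7 ≤ L⁻¹ * t⁻¹ ^ 6 := by
    have : t⁻¹ ^ 7 = t⁻¹ * t⁻¹ ^ 6 := by ring
    rw [this]
    exact mul_le_mul_of_nonneg_right hiL h6
  have h13le : t⁻¹ ^ 13 ≤ t⁻¹ ^ 7 := by
    have : t⁻¹ ^ 13 = t⁻¹ ^ 6 * t⁻¹ ^ 7 := by ring
    rw [this]
    have h61 : t⁻¹ ^ 6 ≤ 1 := pow_le_one₀ hi0 hi1
    nlinarith [pow_nonneg hi0 7]
  have hdiv : 2 / L * t⁻¹ ^ 6 = 2 * (L⁻¹ * t⁻¹ ^ 6) := by rw [div_eq_mul_inv]; ring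
  rw [hdiv]
  refine abs_le.2 ⟨?_, ?_⟩ <;> nlinarith [pow_nonneg hi0 13, pow_nonneg hi0 7]

/-! ### Finite sums over separated sets -/

/-- Over a finite set of points pairwise `≥ ρ` apart and all `≥ ρ` from `r`:
`∑ ‖F(r, ·)‖ ≤ (ρ⁻⁷ + ρ⁻¹) · 250 ρ⁻⁶`. [folklore] -/
theorem sum_norm_force_le (s : Finset E3) (r : E3) {ρ : ℝ} (hρ : 0 < ρ)
    (hr : ∀ y ∈ s, ρ ≤ dist r y) (hs : ∀ y ∈ s, ∀ y' ∈ s, y ≠ y' → ρ ≤ dist y y') :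
    ∑ y ∈ s, ‖(deriv lennardJones (dist r y) / dist r y) • (r - y)‖ ≤ (ρ⁻¹ ^ 7 + ρ⁻¹) * (250 * ρ⁻¹ ^ 6) := by
  calc ∑ y ∈ s, ‖(deriv lennardJones (dist r y) / dist r y) • (r - y)‖
        ≤ ∑ y ∈ s, (ρ⁻¹ ^ 7 + ρ⁻¹) * (dist r y)⁻¹ ^ 6 :=
        Finset.sum_le_sum fun y hy =>
          (norm_force_le r y).trans (abs_deriv_lennardJones_le hρ (hr y hy))
    _ = (ρ⁻¹ ^ 7 + ρ⁻¹) * ∑ y ∈ s, (dist r y)⁻¹ ^ 6 := by rw [Finset.mul_sum]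
    _ ≤ (ρ⁻¹ ^ 7 + ρ⁻¹) * (250 * ρ⁻¹ ^ 6) :=
        mul_le_mul_of_nonneg_left (sum_inv_pow_six_le_of_forall_le_dist s r hρ hr hs)
          (by positivity)

/-- **Uniform far-field tail.** Over a finite set of points pairwise `≥ ρ` apart (`0 < ρ ≤ 1`) and
all at distance `≥ L ≥ 1` from `r`: `∑ ‖F(r, ·)‖ ≤ 500 ρ⁻⁶ / L`. [folklore] -/
theorem sum_norm_force_le_of_far (s : Finset E3) (r : E3) {ρ L : ℝ} (hρ : 0 < ρ) (hρ1 : ρ ≤ 1)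
    (hL : 1 ≤ L) (hr : ∀ y ∈ s, L ≤ dist r y)
    (hs : ∀ y ∈ s, ∀ y' ∈ s, y ≠ y' → ρ ≤ dist y y') :
    ∑ y ∈ s, ‖(deriv lennardJones (dist r y) / dist r y) • (r - y)‖ ≤ 500 * ρ⁻¹ ^ 6 / L := by
  have hr' : ∀ y ∈ s, ρ ≤ dist r y := fun y hy => (hρ1.trans hL).trans (hr y hy)
  calc ∑ y ∈ s, ‖(deriv lennardJones (dist r y) / dist r y) • (r - y)‖ ≤ ∑ y ∈ s, 2 / L * (dist r y)⁻¹ ^ 6 :=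
        Finset.sum_le_sum fun y hy =>
          (norm_force_le r y).trans (abs_deriv_lennardJones_le_of_le hL (hr y hy))
    _ = 2 / L * ∑ y ∈ s, (dist r y)⁻¹ ^ 6 := by rw [Finset.mul_sum]
    _ ≤ 2 / L * (250 * ρ⁻¹ ^ 6) :=
        mul_le_mul_of_nonneg_left (sum_inv_pow_six_le_of_forall_le_dist s r hρ hr' hs)
          (by positivity)
    _ = 500 * ρ⁻¹ ^ 6 / L := by ring

/-! ### Summability over a separated set -/

/-- For a `ρ`-separated `Y` and `p ∈ Y`, the norms `‖F(p, q)‖`, `q ∈ Y ∖ {p}`, have uniformly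
bounded finite partial sums. [folklore] -/
theorem sum_norm_force_subtype_le {Y : Set E3} {ρ : ℝ} (hρ : 0 < ρ)
    (hsep : ∀ p ∈ Y, ∀ q ∈ Y, p ≠ q → ρ ≤ dist p q) {p : E3} (hp : p ∈ Y)
    (u : Finset {q : E3 // q ∈ Y ∧ q ≠ p}) :
    ∑ q ∈ u, ‖(deriv lennardJones (dist p q.1) / dist p q.1) • (p - q.1)‖ ≤ (ρ⁻¹ ^ 7 + ρ⁻¹) * (250 * ρ⁻¹ ^ 6) := by
  classical
  have hinj : Set.InjOn (fun q : {q : E3 // q ∈ Y ∧ q ≠ p} => q.1) u :=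
    fun a _ b _ h => Subtype.ext h
  rw [← Finset.sum_image (f := fun y : E3 => ‖(deriv lennardJones (dist p y) / dist p y) • (p - y)‖) hinj]
  refine sum_norm_force_le _ p hρ ?_ ?_
  · intro y hy
    obtain ⟨q, -, rfl⟩ := Finset.mem_image.1 hy
    exact hsep p hp q.1 q.2.1 (Ne.symm q.2.2)
  · intro y hy y' hy' hne
    obtain ⟨q, -, rfl⟩ := Finset.mem_image.1 hy
    obtain ⟨q', -, rfl⟩ := Finset.mem_image.1 hy'
    exact hsep q.1 q.2.1 q'.1 q'.2.1 hne

/-- For a `ρ`-separated `Y` and `p ∈ Y`, `q ↦ ‖F(p, q)‖` is summable over `{q ∈ Y, q ≠ p}`.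
[folklore] -/
theorem summable_norm_force {Y : Set E3} {ρ : ℝ} (hρ : 0 < ρ)
    (hsep : ∀ p ∈ Y, ∀ q ∈ Y, p ≠ q → ρ ≤ dist p q) {p : E3} (hp : p ∈ Y) :
    Summable fun q : {q : E3 // q ∈ Y ∧ q ≠ p} => ‖(deriv lennardJones (dist p q.1) / dist p q.1) • (p - q.1)‖ :=
  summable_of_sum_le (fun _ => norm_nonneg _) (sum_norm_force_subtype_le hρ hsep hp)

/-- For a `ρ`-separated `Y` and `p ∈ Y`, the force field `q ↦ F(p, q)` is summable over
`{q ∈ Y, q ≠ p}` (absolutely). [folklore] -/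
theorem summable_force {Y : Set E3} {ρ : ℝ} (hρ : 0 < ρ)
    (hsep : ∀ p ∈ Y, ∀ q ∈ Y, p ≠ q → ρ ≤ dist p q) {p : E3} (hp : p ∈ Y) :
    Summable fun q : {q : E3 // q ∈ Y ∧ q ≠ p} => (deriv lennardJones (dist p q.1) / dist p q.1) • (p - q.1) :=
  (summable_norm_force hρ hsep hp).of_norm

/-- **Far-field tail of the series.** For a `ρ`-separated `Y` (`0 < ρ ≤ 1`), `p ∈ Y`, `L ≥ 1` and a
finite set `s` of indices containing every `q ∈ Y ∖ {p}` with `dist p q < L`, the sum of `F(p, ·)`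
over the remaining indices has norm `≤ 500 ρ⁻⁶ / L`. [folklore] -/
theorem norm_tsum_force_compl_le {Y : Set E3} {ρ L : ℝ} (hρ : 0 < ρ) (hρ1 : ρ ≤ 1) (hL : 1 ≤ L)
    (hsep : ∀ p ∈ Y, ∀ q ∈ Y, p ≠ q → ρ ≤ dist p q) {p : E3} (hp : p ∈ Y)
    (s : Finset {q : E3 // q ∈ Y ∧ q ≠ p})
    (hs : ∀ q : {q : E3 // q ∈ Y ∧ q ≠ p}, dist p q.1 < L → q ∈ s) :
    ‖∑' q : {q : {q : E3 // q ∈ Y ∧ q ≠ p} // q ∉ s},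
        (deriv lennardJones (dist p q.1.1) / dist p q.1.1) • (p - q.1.1)‖ ≤ 500 * ρ⁻¹ ^ 6 / L := by
  classical
  have hsum : Summable fun q : {q : {q : E3 // q ∈ Y ∧ q ≠ p} // q ∉ s} =>
      ‖(deriv lennardJones (dist p q.1.1) / dist p q.1.1) • (p - q.1.1)‖ :=
    (summable_norm_force hρ hsep hp).subtype _
  refine (norm_tsum_le_tsum_norm hsum).trans ?_
  refine hsum.tsum_le_of_sum_le fun u => ?_
  -- push the finite partial sum down to a finite set of points of `Y`
  have hinj : Set.InjOn (fun q : {q : {q : E3 // q ∈ Y ∧ q ≠ p} // q ∉ s} => q.1.1) u :=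
    fun a _ b _ h => Subtype.ext (Subtype.ext h)
  rw [← Finset.sum_image (f := fun y : E3 => ‖(deriv lennardJones (dist p y) / dist p y) • (p - y)‖) hinj]
  refine sum_norm_force_le_of_far _ p hρ hρ1 hL ?_ ?_
  · intro y hy
    obtain ⟨q, -, rfl⟩ := Finset.mem_image.1 hy
    by_contra hlt
    exact q.2 (hs q.1 (not_le.1 hlt))
  · intro y hy y' hy' hne
    obtain ⟨q, -, rfl⟩ := Finset.mem_image.1 hy
    obtain ⟨q', -, rfl⟩ := Finset.mem_image.1 hy'
    exact hsep _ q.1.2.1 _ q'.1.2.1 hne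

end Summit.AtomisticToContinuum.Crystallization.Theorems.ExcessDecayLiouvilleGrainsGlue

end
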